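import Summits.HodgeConjecture.HodgeConjecture.Theorems.HCCMUnconditionalOfGenericFloorV2
import Summits.HodgeConjecture.HodgeConjecture.Theorems.HCCMUnconditionalHDelOfMumford
import HarnessLib

/-!
# HC_CM modulo the GENERIC FLOOR — edition FLOOR-G v3 (`hc_cm_of_generic_floor_v3`, Mumford currency)

Director g6 RULING s90 (B4) (2026-08-28; s88 ROAD60-CLOSE §3 plan of record, s87 (2) the six-input generic floor).  Edition v2 ★ p654493
`hc_cm_of_generic_floor_v2` (`HCCMUnconditionalOfGenericFloorV2.lean`) takes row I-7 #60 `hS1 : SiegelS1` ([Deligne1971TravauxShimura] Thm. 4.21: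
«Mumford's model of the Siegel modular variety is canonical») as a hypothesis.  Under s90 that row is DERIVED in the tree from the reciprocity-free,
CM-free named fact M1′ ★ `Literature.AlgebraicGeometry.ModuliOfAbelianVarieties.deligne1971_siegelModuliOnPoints` ([Deligne1971TravauxShimura] 4.16–4.17
and the proof of Thm. 4.21 (a)–(c); [MumfordFogartyKirwan1994] Thm. 7.9 + App. 7A: Mumford's moduli scheme is a model over `ℚ` of the Siegel modular
variety ON POINTS) by ★ `Summit.HodgeConjecture.HodgeConjecture.Theorems.siegelS1_of_mumford` (`HCCMUnconditionalHDelOfMumford.lean`, s90 (B2): [Milne2005ShimuraVarieties]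
Prop. 14.12 «moduli ⇒ canonical» through the tree's `MumfordModuli` receptacle and ★ `MumfordRouteXi` assembly).  This file is the one-line
re-pointing `hS1 := siegelS1_of_mumford hM`; v1, v2 and the print-exact floor ★ `hc_cm_of_floor_v10` (FLOOR 6) stay intact in their own files.

Hypotheses = EXACTLY SIX: I-9 #62 `hM : deligne1971_siegelModuliOnPoints` (GENERIC, unproved), III-2 (a)′ `hdictE`, III-J3a `hJ3a`, III-2 (c)′ `hocc`,
VI-1 `hFal`, III-9′ `h415` (binder texts token-identical to v1 / v2 / v10) — the GENERIC six-input floor in Mumford currency beside the PRINT-EXACT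
six-input floor ★ p638725 {[Liu21, 5.6], (a)′, J3a, (c)′, [Fal83], [Liu21, 4.15]}.  Fan A unchanged (item 24835 `HDel` stays OPEN until #62 is itself
a theorem over Mathlib: registered residual `stub_mumford`).

A STATUS theorem, not a discharge: HC_CM is proved only modulo the 7 printed citations until rung 0 closes.
-/

set_option autoImplicit false

-- mandated namespace `Summit.HodgeConjecture.HodgeConjecture.Theorems` trips `linter.dupNamespace` (single-problem summit); off as in
-- `HCCMUnconditionalOfFloor.lean` / `HCCMUnconditionalOfGenericFloorV2.lean`.
set_option linter.dupNamespace false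

noncomputable section

namespace Summit.HodgeConjecture.HodgeConjecture.Theorems

open scoped TensorProduct Matrix
open NumberField NumberField.InfinitePlace IsDedekindDomain
open HodgeCM.Model HodgeCM.Model.LiuIndex HodgeCM.Model.TowerCarrier
open Summit.HodgeConjecture.CorCM.Model
open Literature.AlgebraicGeometry.Motives (CMType AbelianVariety)
open Literature.AlgebraicGeometry.HodgeTheory Literature.NumberTheory.Automorphic.PicardCM
open Literature.AlgebraicGeometry.ShimuraVarieties Literature.AlgebraicGeometry.ShimuraVarieties.UnitaryCanonicalModel
open Literature.NumberTheory.ComplexMultiplication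
open Literature.NumberTheory.Automorphic
open Literature.NumberTheory.Automorphic.Liu2021 Literature.NumberTheory.Automorphic.Liu2021.AppendixC
open Literature.NumberTheory.Automorphic.Liu2021.Def411WeilCarriers (lineOf locF Rep)
open Summit.HodgeConjecture.CorCM.Transposition.OmegaTransport (realUnit)
open HodgeCM.Model.ArchSideTerm (e₁)
open Literature.NumberTheory.GelbartRogawski1991 Literature.NumberTheory.GelbartRogawski1991.UnitaryDualPair
open Literature.RepresentationTheory Literature.RepresentationTheory.Liu2021
open Summit.HodgeConjecture.CorCM
open Summit.HodgeConjecture.CorCM.Transposition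
open Literature.NumberTheory.GelbartRogawski1991.OscillatorTripleDictionary (OccursInH1 IsIsoToOmega)
open Summit.HodgeConjecture.CorCM.Lines.A3Liu418 (Thm415AtFace EpsRigidAtFace)
open Summit.HodgeConjecture.HodgeConjecture.Theses (HCCMUnconditional.HDel)

set_option synthInstance.maxHeartbeats 400000 in
set_option maxHeartbeats 8000000 in
/-- **GENERIC FLOOR EDITION v3 (Mumford currency; director g6 RULING s90 (B4))**: `hc_cm_of_generic_floor_v2` with its binder I-7 `hS1 : SiegelS1`
discharged by `siegelS1_of_mumford hM` from the generic named fact M1′ `hM : deligne1971_siegelModuliOnPoints` ([Deligne1971TravauxShimura] 4.16–4.17 /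
Thm. 4.21; [MumfordFogartyKirwan1994] Thm. 7.9, App. 7A; [Milne2005ShimuraVarieties] Prop. 14.12); one-line body by name, the other five binders
token-identical to v1 / v2.  Hypotheses = EXACTLY: M1′ `hM`, III-2 (a)′ `hdictE`, III-J3a `hJ3a`, III-2 (c)′ `hocc`, VI-1 `hFal`, III-9′ `h415`
(**6**, generic kind).  A STATUS theorem: HC_CM is proved only modulo the 7 printed citations until rung 0 closes.
[cite: Deligne1971TravauxShimura, 4.16–4.21 pp. 150–152] [cite: MumfordFogartyKirwan1994, Thm. 7.9 and App. 7A] [cite: Milne2005ShimuraVarieties, Prop. 14.12 p. 125]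
[cite: Liu2021, Thm. 4.18; Prop. 4.13 and its proof l. 2145; Rem. 4.14; Thm. 4.15; App. D Lem. D.1] [cite: GelbartRogawski1991, Thm. 5.1.1 (p. 448); p. 446]
[cite: Li1992, Thm. 2.1] [cite: Rogawski1990, Thm. 13.3.1] [cite: Shimura1998, Thm. 21.4; Thm. 18.6] [cite: Faltings1983, Satz 4] -/
theorem hc_cm_of_generic_floor_v3
    -- `hDel` ⇐ row I-9 #62 M1′ `hM` (Mumford's moduli model on points) via `siegelS1_of_mumford` (s90 (B2)) and ★ `hc_cm_of_generic_floor_v2`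
    (hM : Literature.AlgebraicGeometry.ModuliOfAbelianVarieties.deligne1971_siegelModuliOnPoints)
    -- `h21` := the closed constant `Theorems.H21_proof` ([Shimura1998] Thm. 21.4 in Serre–Tate currency ⇐ Thm. 18.6 ★ p631138); NO r₀, NO NOS
    -- `h413` ⇐ rows III-2 (a)′ EXISTENCE, III-J3a, III-2 (c)′ «admissible ⇒ occurs in H¹» at the printed datum (E-III2 R1′, print-exact)
    (hdictE :
      ∀ (hDel : Literature.AlgebraicGeometry.ShimuraVarieties.UnitaryCanonicalModel.canonicalModel_exists_printed)
        (F : HodgeCM.CMField) [IsGalois ℚ F] (h6 : 6 ≤ Module.finrank ℚ F) {ι₁ : F →+* ℂ} (V : HodgeCM.HermSpace3 F ι₁) (a₀ : RealScalar F)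
        (Φ : CMType F) (hΦ : ι₁ ∈ Φ.1) (i : (I V (repAt a₀) (muLiu ι₁ GramClass.rep))),
        oscillatorTriple_dictionaryExistence (((uniformOmegaRep (Summit.HodgeConjecture.CorCM.DelRec.exists_recordSystem_of_printed hDel) ⟨HodgeCM.CMField.K F⟩ ι₁ ⟨HodgeCM.HermSpace3.Hm V, HodgeCM.HermSpace3.isHermitian V, HodgeCM.HermSpace3.signature_ι₁ V, HodgeCM.HermSpace3.posDef_of_ne V⟩ Φ e₁ (frameD V) (frameD_real V) (frameD_ne V) (ιVE V) (2 * imagUnit (HodgeCM.CMField.K F))⁻¹ (fun _ _ => (Rep.update ↥(maximalRealSubfield (HodgeCM.CMField.K F)) (imagUnitSq (HodgeCM.CMField.K F)) (Rep.ofLineOf ↥(maximalRealSubfield (HodgeCM.CMField.K F)) (imagUnitSq (HodgeCM.CMField.K F))) (locF ↥(maximalRealSubfield (HodgeCM.CMField.K F)) (imagUnitSq (HodgeCM.CMField.K F)) (realUnit ⟨HodgeCM.CMField.K F⟩ (repAt a₀ (Sigma.fst i)).1 (repAt a₀ (Sigma.fst i)).2.1 (repAt a₀ (Sigma.fst i)).2.2))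 (realUnit ⟨HodgeCM.CMField.K F⟩ (repAt a₀ (Sigma.fst i)).1 (repAt a₀ (Sigma.fst i)).2.1 (repAt a₀ (Sigma.fst i)).2.2) rfl)))).prop413Data ((liuDictionaryPin exists_isReal_hodgeModel_holds hodgePQ_independent_of_hodgeModel_holds BallQuotient.ballQuotientUniformised_holds (cmAbelianVarietyRealised_of_eigenbasis exists_isReal_hodgeModel_holds hodgePQ_independent_of_hodgeModel_holds cmAbelianVarietyEigenbasisRealised_holds) Literature.NumberTheory.Transcendental.arapura2012_cor_15_4_6_holds V (I V (repAt a₀) (muLiu ι₁ GramClass.rep)) (line V (repAt a₀) (muLiu ι₁ GramClass.rep)))).H))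
    (hJ3a :
      ∀ (hDel : Literature.AlgebraicGeometry.ShimuraVarieties.UnitaryCanonicalModel.canonicalModel_exists_printed)
        (F : HodgeCM.CMField) [IsGalois ℚ F] (h6 : 6 ≤ Module.finrank ℚ F) {ι₁ : F →+* ℂ} (V : HodgeCM.HermSpace3 F ι₁) (a₀ : RealScalar F)
        (Φ : CMType F) (hΦ : ι₁ ∈ Φ.1) (i : (I V (repAt a₀) (muLiu ι₁ GramClass.rep))),
        (((uniformOmegaRep (Summit.HodgeConjecture.CorCM.DelRec.exists_recordSystem_of_printed hDel) ⟨HodgeCM.CMField.K F⟩ ι₁ ⟨HodgeCM.HermSpace3.Hm V, HodgeCM.HermSpace3.isHermitian V, HodgeCM.HermSpace3.signature_ι₁ V, HodgeCM.HermSpace3.posDef_of_ne V⟩ Φ e₁ (frameD V) (frameD_real V) (frameD_ne V) (ιVE V) (2 * imagUnit (HodgeCM.CMField.K F))⁻¹ (fun _ _ => (Rep.update ↥(maximalRealSubfield (HodgeCM.CMField.K F)) (imagUnitSq (HodgeCM.CMField.K F)) (Rep.ofLineOf ↥(maximalRealSubfield (HodgeCM.CMField.K F)) (imagUnitSq (HodgeCM.CMField.K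 F))) (locF ↥(maximalRealSubfield (HodgeCM.CMField.K F)) (imagUnitSq (HodgeCM.CMField.K F)) (realUnit ⟨HodgeCM.CMField.K F⟩ (repAt a₀ (Sigma.fst i)).1 (repAt a₀ (Sigma.fst i)).2.1 (repAt a₀ (Sigma.fst i)).2.2)) (realUnit ⟨HodgeCM.CMField.K F⟩ (repAt a₀ (Sigma.fst i)).1 (repAt a₀ (Sigma.fst i)).2.1 (repAt a₀ (Sigma.fst i)).2.2) rfl)))).prop413Data ((liuDictionaryPin exists_isReal_hodgeModel_holds hodgePQ_independent_of_hodgeModel_holds BallQuotient.ballQuotientUniformised_holds (cmAbelianVarietyRealised_of_eigenbasis exists_isReal_hodgeModel_holds hodgePQ_independent_of_hodgeModel_holds cmAbelianVarietyEigenbasisRealised_holds) Literature.NumberTheory.Transcendental.arapura2012_cor_15_4_6_holds V (I V (repAt a₀) (muLiu ι₁ GramClass.rep)) (line V (repAt a₀) (muLiu ι₁ GramClass.rep)))).H).multiplicity_le_one_printed)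
    (hocc :
      ∀ (hDel : Literature.AlgebraicGeometry.ShimuraVarieties.UnitaryCanonicalModel.canonicalModel_exists_printed)
        (F : HodgeCM.CMField) [IsGalois ℚ F] (h6 : 6 ≤ Module.finrank ℚ F) {ι₁ : F →+* ℂ} (V : HodgeCM.HermSpace3 F ι₁) (a₀ : RealScalar F)
        (Φ : CMType F) (hΦ : ι₁ ∈ Φ.1) (i : (I V (repAt a₀) (muLiu ι₁ GramClass.rep))),
        admissible_occursInH1 (((uniformOmegaRep (Summit.HodgeConjecture.CorCM.DelRec.exists_recordSystem_of_printed hDel) ⟨HodgeCM.CMField.K F⟩ ι₁ ⟨HodgeCM.HermSpace3.Hm V, HodgeCM.HermSpace3.isHermitian V, HodgeCM.HermSpace3.signature_ι₁ V, HodgeCM.HermSpace3.posDef_of_ne V⟩ Φ e₁ (frameD V) (frameD_real V) (frameD_ne V) (ιVE V) (2 * imagUnit (HodgeCM.CMField.K F))⁻¹ (fun _ _ => (Rep.update ↥(maximalRealSubfield (HodgeCM.CMField.K F)) (imagUnitSq (HodgeCM.CMField.K F)) (Rep.ofLineOf ↥(maximalRealSubfield (HodgeCM.CMField.K F)) (imagUnitSq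 (HodgeCM.CMField.K F))) (locF ↥(maximalRealSubfield (HodgeCM.CMField.K F)) (imagUnitSq (HodgeCM.CMField.K F)) (realUnit ⟨HodgeCM.CMField.K F⟩ (repAt a₀ (Sigma.fst i)).1 (repAt a₀ (Sigma.fst i)).2.1 (repAt a₀ (Sigma.fst i)).2.2)) (realUnit ⟨HodgeCM.CMField.K F⟩ (repAt a₀ (Sigma.fst i)).1 (repAt a₀ (Sigma.fst i)).2.1 (repAt a₀ (Sigma.fst i)).2.2) rfl)))).prop413Data ((liuDictionaryPin exists_isReal_hodgeModel_holds hodgePQ_independent_of_hodgeModel_holds BallQuotient.ballQuotientUniformised_holds (cmAbelianVarietyRealised_of_eigenbasis exists_isReal_hodgeModel_holds hodgePQ_independent_of_hodgeModel_holds cmAbelianVarietyEigenbasisRealised_holds) Literature.NumberTheory.Transcendental.arapura2012_cor_15_4_6_holds V (I V (repAt a₀) (muLiu ι₁ GramClass.rep)) (line V (repAt a₀) (muLiu ι₁ GramClass.rep)))).H))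
    -- `hLiu418` ⇐ rows VI-1, III-9′ (III-0 Liu Lem. 2.4 (1) and III-11 by their CLOSED tree terms)
    (hFal : ∀ {K : Type} [Field K] (A B : AbelianVariety K) (ℓ : ℕ) [Fact ℓ.Prime], Literature.AlgebraicGeometry.Motives.faltings_tate_bijective A B ℓ)
    (h415 : Thm415AtFace) :
    Summit.HodgeConjecture.HodgeConjecture.Theses.RankFourFaces.CMAbelianHodge :=
  hc_cm_of_generic_floor_v2 (siegelS1_of_mumford hM) hdictE hJ3a hocc hFal h415

end Summit.HodgeConjecture.HodgeConjecture.Theorems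

end
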